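import Summits.KontsevichZagierPeriods.Zeta5Search.TwoTaleOmega.StepER
import Summits.KontsevichZagierPeriods.Zeta5Search.TwoTaleOmega.StepFL

/-!
# (bmiss)@Ω — the recurrence in direction `f`, SECOND TALE (cell `pub-zeta5`, cert-1 gen 4)

HONEST FRAMING: systematic search; recurrence certificates; no irrationality claim unless certified. Pure finite algebra
over `ℚ`; no named fact, no `sorry`.

Blueprint `families/tele/RECURRENCE.md` §13.10–13.12, direction `δ = f`, side `R` (lattice variable `u = 2t`); the mirror of
`StepER`. INPUT: cert-2's `telescope_f_R` (same `Cert_R` shape as for `e`, `x_R` constant `xFRv`; atoms opaque, `CertAtomsF`).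
Along `δ_f` the numerator block `[a−b+1,f)` and the denominator block `[e,e+f)` both grow at the top:
`F_R(p+kδ;u)·block(e+f,e+f+k)(t) = (−1)^k ∏_{j<k}(f−a+e+j)(f+j) · block(f,f+k)(t) · F_R(p;u)` (`kap_addF`, `vR_ratio_addF`).
Telescoped function `GfFR = ofFrac (2·[e,e+f+2) ∪ 2·[a,g−1)) (C(x_R·κ·2^{g−b+1})·block(a−1,g−b+a)·eblock(a−b,f))`; common node
`M* = −a`. OUTPUT `recR_f`.
-/

noncomputable section

open Finset Polynomial
open Literature.NumberTheory.Irrationality.Zudilin2014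
open Summit.KontsevichZagierPeriods.Zeta5Search.FormalBarnes
open Summit.KontsevichZagierPeriods.Zeta5Search.Certificates.TwoTaleTelescope

namespace Summit.KontsevichZagierPeriods.Zeta5Search.TwoTaleOmega

namespace Pt

variable (p : Pt)

/-! ### Motion along `δ_f` in the second tale -/

/-- `ε` alternates along `δ_f`. -/
theorem eps_addF (k : ℕ) : (p.addF k).eps = (-1) ^ k * p.eps := by
  unfold eps
  rw [neg_one_pow_natAbs, neg_one_pow_natAbs, show (p.addF k).a + (p.addF k).b + (p.addF k).e + (p.addF k).f
    = (p.a + p.b + p.e + p.f) + (k : ℕ) by simp only [addF_a, addF_b, addF_e, addF_f]; ring, zpow_add₀ (by norm_num), zpow_natCast]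
  ring

/-- `κ` along `δ_f`: `κ(p + kδ_f) = (−1)^k · ∏_{j<k}(f−a+e+j) · ∏_{j<k}(f+j) · κ(p)` (for `f−a+e−1 ≥ 0`, `f ≥ 1`). -/
theorem kap_addF (k : ℕ) (h1 : 0 ≤ p.f - p.a + p.e - 1) (h2 : 0 ≤ p.f - 1) :
    (p.addF k).kap = (-1) ^ k * (∏ j ∈ range k, ((p.f : ℚ) - p.a + p.e - 1 + j + 1)) * (∏ j ∈ range k, ((p.f : ℚ) - 1 + j + 1))
      * p.kap := by
  have f1 := facZ_add_nat h1 k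
  have f2 := facZ_add_nat h2 k
  unfold kap
  rw [eps_addF]
  simp only [addF_a, addF_b, addF_e, addF_f, addF_g]
  rw [show p.f + (k : ℤ) - p.a + p.e - 1 = p.f - p.a + p.e - 1 + k by ring, show p.f + (k : ℤ) - 1 = p.f - 1 + k by ring, f1, f2]
  push_cast
  ring

variable {p}

/-- **Γ-ratio along `δ_f`, second tale**:
`F_R(p+kδ_f;u)·block(e+f,e+f+k)(u/2) = (−1)^k ∏_{j<k}(f−a+e+j) ∏_{j<k}(f+j) · block(f,f+k)(u/2) · F_R(p;u)`. -/
theorem vR_ratio_addF (h : p.Omega) (k : ℕ) (hk : (p.addF k).Omega) {u : ℚ} (hu : ∀ K ∈ Icc 1 (4 * p.g), u + K ≠ 0) :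
    (p.addF k).vR.eval u * (block (p.e + p.f) (p.e + p.f + k)).eval (u / 2)
      = (-1) ^ k * (∏ j ∈ range k, ((p.f : ℚ) - p.a + p.e - 1 + j + 1)) * (∏ j ∈ range k, ((p.f : ℚ) - 1 + j + 1))
        * (block p.f (p.f + k)).eval (u / 2) * p.vR.eval u := by
  obtain ⟨o1, o2, o3, o4, o5, o6, o7, o8, o9⟩ := id h
  have hp := h.pos
  have hden : (denT p.t2a p.t2b).eval (u / 2) ≠ 0 := denT_ne_zero_Icc h hu
  have hdenk : (denT (p.addF k).t2a (p.addF k).t2b).eval (u / 2) ≠ 0 := denT_ne_zero_Icc hk (by simpa using hu)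
  rw [vR_eval_blocks _ hk.admissibleT hdenk, vR_eval_blocks _ h.admissibleT hden, kap_addF p k (by omega) (by omega)]
  simp only [addF_a, addF_b, addF_e, addF_f, addF_g]
  rw [denT_eq, Polynomial.eval_mul] at hden hdenk
  simp only [addF_a, addF_e, addF_f, addF_g] at hdenk
  rw [← block_mul_block (lo := p.a - p.b + 1) (mi := p.f) (hi := p.f + k) (by omega) (by omega),
    show p.e + (p.f + (k : ℤ)) = p.e + p.f + k by ring,
    ← block_mul_block (lo := p.e) (mi := p.e + p.f) (hi := p.e + p.f + k) (by omega) (by omega)]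
  rw [show p.e + (p.f + (k : ℤ)) = p.e + p.f + k by ring,
    ← block_mul_block (lo := p.e) (mi := p.e + p.f) (hi := p.e + p.f + k) (by omega) (by omega)] at hdenk
  simp only [Polynomial.eval_mul] at hdenk ⊢
  rw [div_mul_eq_mul_div, mul_div_assoc', div_eq_div_iff hdenk hden]
  ring

/-! ### The telescoped function `G = Cert_R · F_R(p;·)` as closed-form data -/

variable (p)

/-- The rational certificate `Cert_R(p; u/2)` of direction `f` in the lattice variable. -/
def certFR (u : ℚ) : ℚ :=
  (u + p.a - 1) * (u + p.a) * (u / 2 + (p.a - p.b : ℤ)) * (u / 2 + (p.g - 1 : ℤ)) * (u / 2 + (p.e + p.f + 2 : ℤ))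
    * xFRv (p.a : ℚ) p.b p.e p.f p.g / ((u / 2 + (p.e + p.f : ℤ)) * (u / 2 + (p.e + p.f + 1 : ℤ)) * (u / 2 + (p.e + p.f + 2 : ℤ)))

/-- Numerator of `G_{f,R}` on the even lattice. -/
def NGFR : ℚ[X] :=
  C (xFRv (p.a : ℚ) p.b p.e p.f p.g * p.kap * 2 ^ (p.g - p.b + 1).toNat) * (block (p.a - 1) (p.g - p.b + p.a) * eblock (p.a - p.b) p.f)

/-- **The telescoped data** `G_{f,R}(p)`. -/
def GfFR : PF := PF.ofFrac (p.AGe ∪ p.BG) (twoRange p.AGe p.BG) p.NGFR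

variable {p}

/-- The polynomial part of `G_{f,R}` is constant. -/
theorem natDegree_GfFR (h : p.Omega) : p.GfFR.poly.natDegree = 0 := by
  obtain ⟨o1, o2, o3, o4, o5, o6, o7, o8, o9⟩ := h
  unfold GfFR
  rw [PF.natDegree_ofFrac, sum_twoRange]
  have hN : p.NGFR.natDegree ≤ (p.g - p.b + p.a - (p.a - 1)).toNat + (p.f - (p.a - p.b)).toNat := by
    unfold NGFR
    refine (natDegree_C_mul_le _ _).trans ((natDegree_mul_le).trans ?_)
    rw [natDegree_block, natDegree_eblock]
  unfold AGe BG
  rw [card_image_of_injective _ fun x y h => mul_left_cancel₀ two_ne_zero h,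
    card_image_of_injective _ fun x y h => mul_left_cancel₀ two_ne_zero h, Int.card_Ico, Int.card_Ico]
  omega

/-- **`G = Cert_R · F_R`**: off the exceptional lattice, `G_{f,R}(u) = Cert_R(u/2)·vR(p)(u)`. -/
theorem GfFR_eq_cert (h : p.Omega) {u : ℚ} (hu : ∀ K ∈ Icc 1 (5 * p.g), u + K ≠ 0) :
    p.GfFR.eval u = p.certFR u * p.vR.eval u := by
  have hp := h.pos
  obtain ⟨o1, o2, o3, o4, o5, o6, o7, o8, o9⟩ := id h
  have hu4 : ∀ K ∈ Icc 1 (4 * p.g), u + K ≠ 0 := fun K hK => hu K (by rw [mem_Icc] at hK ⊢; omega)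
  have huG : ∀ K ∈ p.AGe ∪ p.BG, u + K ≠ 0 := fun K hK => hu K (mem_Icc.2 (mem_Icc_of_mem_e h hK))
  have huR : ∀ K ∈ p.AR ∪ p.BR, u + K ≠ 0 := fun K hK => hu4 K (mem_Icc.2 (mem_Icc_of_mem h (Or.inr hK)))
  rw [vR_eq_ofFrac h]
  unfold GfFR
  rw [PF.eval_ofFrac _ _ _ (fun _ hk => twoRange_mem hk) huG, PF.eval_ofFrac _ _ _ (fun _ hk => twoRange_mem hk) huR,
    denom_twoRange, denom_twoRange]
  unfold AGe BG AR BR NGFR NR certFR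
  rw [← eblock_eq_prod_image, ← eblock_eq_prod_image, ← eblock_eq_prod_image, ← eblock_eq_prod_image]
  rw [block_succ_left (lo := p.a - 1) (hi := p.g - p.b + p.a) (by omega),
    block_succ_left (lo := p.a - 1 + 1) (hi := p.g - p.b + p.a) (by omega),
    show p.a - 1 + 1 + 1 = p.a + 1 by ring, show p.a - 1 + 1 = p.a by ring,
    eblock_succ_left (lo := p.a - p.b) (hi := p.f) (by omega),
    show p.e + p.f + 2 = (p.e + p.f + 1) + 1 by ring, eblock_succ_right (lo := p.e) (hi := p.e + p.f + 1) (by omega),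
    show p.e + p.f + 1 = (p.e + p.f) + 1 by ring, eblock_succ_right (lo := p.e) (hi := p.e + p.f) (by omega),
    show p.g = (p.g - 1) + 1 by ring, eblock_succ_right (lo := p.a) (hi := p.g - 1) (by omega)]
  simp only [show p.g - 1 + 1 = p.g by ring]
  simp only [Polynomial.eval_mul, Polynomial.eval_C, eval_lin]
  have nz : ∀ K : ℤ, 1 ≤ K → K ≤ 5 * p.g → u + K ≠ 0 := fun K h1 h2 => hu K (mem_Icc.2 ⟨h1, h2⟩)
  have hDe : (eblock p.e (p.e + p.f)).eval u ≠ 0 := by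
    rw [eval_eblock]; exact prod_ne_zero_iff.2 fun i hi heq => nz (2 * i) (by rw [mem_Ico] at hi; omega)
      (by rw [mem_Ico] at hi; omega) (by push_cast; exact heq)
  have hDa : (eblock p.a (p.g - 1)).eval u ≠ 0 := by
    rw [eval_eblock]; exact prod_ne_zero_iff.2 fun i hi heq => nz (2 * i) (by rw [mem_Ico] at hi; omega)
      (by rw [mem_Ico] at hi; omega) (by push_cast; exact heq)
  have n1 := nz (2 * (p.e + p.f)) (by omega) (by omega)
  have n2 := nz (2 * (p.e + p.f + 1)) (by omega) (by omega)
  have n3 := nz (2 * (p.e + p.f + 2)) (by omega) (by omega)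
  have n4 := nz (2 * (p.g - 1)) (by omega) (by omega)
  push_cast at n1 n2 n3 n4 ⊢
  rw [show u / 2 + ((p.e : ℚ) + p.f) = (u + 2 * ((p.e : ℚ) + p.f)) / 2 by ring,
    show u / 2 + ((p.e : ℚ) + p.f + 1) = (u + 2 * ((p.e : ℚ) + p.f + 1)) / 2 by ring,
    show u / 2 + ((p.e : ℚ) + p.f + 1 + 1) = (u + 2 * ((p.e : ℚ) + p.f + 2)) / 2 by ring]
  field_simp
  ring

/-! ### Step (2): the function identity -/

set_option maxHeartbeats 1600000 in
/-- **Function identity** `Σ_k c^f_k(p) F_R(p+kδ_f;u) = G(u+2) − G(u)` off the exceptional set `SeR = [−4g, 6g]`. -/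
theorem funId_fR (h0 : p.Omega) (h1 : (p.addF 1).Omega) (h2 : (p.addF 2).Omega) (h3 : (p.addF 3).Omega) {u : ℚ}
    (hu : ∀ K ∈ p.SeR, u + K ≠ 0) :
    p.coefF 0 * p.vR.eval u + p.coefF 1 * (p.addF 1).vR.eval u + p.coefF 2 * (p.addF 2).vR.eval u
      + p.coefF 3 * (p.addF 3).vR.eval u = p.GfFR.eval (u + 2) - p.GfFR.eval u := by
  have hp := h0.pos
  obtain ⟨o1, o2, o3, o4, o5, o6, o7, o8, o9⟩ := id h0
  have nz : ∀ K : ℤ, -(4 * p.g) ≤ K → K ≤ 6 * p.g → u + K ≠ 0 := fun K hK1 hK2 => hu K (by unfold SeR; rw [mem_Icc]; omega)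
  have hu5 : ∀ K ∈ Icc 1 (5 * p.g), u + K ≠ 0 := fun K hK => by rw [mem_Icc] at hK; exact nz K (by omega) (by omega)
  have hu4 : ∀ K ∈ Icc 1 (4 * p.g), u + K ≠ 0 := fun K hK => by rw [mem_Icc] at hK; exact nz K (by omega) (by omega)
  have hu5' : ∀ K ∈ Icc 1 (5 * p.g), u + 2 + K ≠ 0 := fun K hK => by
    rw [mem_Icc] at hK; have := nz (K + 2) (by omega) (by omega); push_cast at this; rwa [add_assoc, add_comm (2:ℚ)]
  have huR : ∀ K ∈ p.AR ∪ p.BR, u + K ≠ 0 := fun K hK => hu4 K (mem_Icc.2 (mem_Icc_of_mem h0 (Or.inr hK)))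
  have huR2 : ∀ K ∈ p.AR ∪ p.BR, u + 2 + K ≠ 0 := fun K hK => by
    have hb := mem_Icc_of_mem h0 (Or.inr hK)
    have := nz (K + 2) (by omega) (by omega); push_cast at this; rwa [add_assoc, add_comm (2:ℚ)]
  -- the four values
  set F0 := p.vR.eval u with hF0
  set F0' := p.vR.eval (u + 2) with hF0'
  have r1 := vR_ratio_addF h0 1 h1 hu4
  have r2 := vR_ratio_addF h0 2 h2 hu4
  have r3 := vR_ratio_addF h0 3 h3 hu4
  have eb1 := (eval_block_123 (p.e + p.f) (u / 2)).1
  have eb2 := (eval_block_123 (p.e + p.f) (u / 2)).2.1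
  have eb3 := (eval_block_123 (p.e + p.f) (u / 2)).2.2
  have nb1 := (eval_block_123 p.f (u / 2)).1
  have nb2 := (eval_block_123 p.f (u / 2)).2.1
  have nb3 := (eval_block_123 p.f (u / 2)).2.2
  push_cast at r1 r2 r3 eb1 eb2 eb3 nb1 nb2 nb3
  rw [eb1, nb1] at r1
  rw [eb2, nb2] at r2
  rw [eb3, nb3] at r3
  simp only [prod_range_succ, prod_range_zero] at r1 r2 r3
  push_cast at r1 r2 r3
  -- the shift and the values of G
  have hS := vR_shift h0 huR huR2
  rw [← hF0, ← hF0'] at hS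
  push_cast at hS
  have eG0 := GfFR_eq_cert h0 hu5
  have eG2 := GfFR_eq_cert h0 (u := u + 2) hu5'
  rw [← hF0] at eG0
  rw [← hF0'] at eG2
  -- cert-2's cleared identity at t = u/2, atoms kept opaque
  have hc := telescope_f_R (p.a : ℚ) p.b p.e p.f p.g (u / 2)
  simp only [numFR0, denFR0, lprod_nil, mul_one, one_mul, polyTN_xFR] at hc
  have c0 : p.coefF 0 = spvalC Certificates.TwoTaleTelescope.cF0 (p.a : ℚ) p.b p.e p.f p.g := rfl
  have c1 : p.coefF 1 = spvalC Certificates.TwoTaleTelescope.cF1 (p.a : ℚ) p.b p.e p.f p.g := rfl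
  have c2 : p.coefF 2 = spvalC Certificates.TwoTaleTelescope.cF2 (p.a : ℚ) p.b p.e p.f p.g := rfl
  have c3 : p.coefF 3 = spvalC Certificates.TwoTaleTelescope.cF3 (p.a : ℚ) p.b p.e p.f p.g := rfl
  -- non-vanishing of the cleared denominators
  have hd1 := nz (2 * (p.e + p.f)) (by omega) (by omega)
  have hd2 := nz (2 * (p.e + p.f + 1)) (by omega) (by omega)
  have hd3 := nz (2 * (p.e + p.f + 2)) (by omega) (by omega)
  have hd4 := nz (2 * (p.e + p.f + 3)) (by omega) (by omega)
  have ht1 := nz (p.a + 1) (by omega) (by omega)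
  have ht2 := nz (p.a + 2) (by omega) (by omega)
  have ht3 := nz (2 * (p.a - p.b + 1)) (by omega) (by omega)
  have ht4 := nz (2 * (p.e + p.f)) (by omega) (by omega)
  have ht5 := nz (2 * p.g) (by omega) (by omega)
  push_cast at hd1 hd2 hd3 hd4 ht1 ht2 ht3 ht4 ht5
  have key := telescope_assembly (F0 := F0) (F0' := F0')
    (F1 := (p.addF 1).vR.eval u) (F2 := (p.addF 2).vR.eval u) (F3 := (p.addF 3).vR.eval u)
    (c0 := p.coefF 0) (c1 := p.coefF 1) (c2 := p.coefF 2) (c3 := p.coefF 3)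
    (s1 := -1) (s2 := 1) (s3 := -1)
    (n1 := lprod numFR1 (p.a : ℚ) p.b p.e p.f p.g (u / 2)) (n2 := lprod numFR2 (p.a : ℚ) p.b p.e p.f p.g (u / 2))
    (n3 := lprod numFR3 (p.a : ℚ) p.b p.e p.f p.g (u / 2))
    (d1 := lprod denFR1 (p.a : ℚ) p.b p.e p.f p.g (u / 2)) (d2 := lprod denFR2 (p.a : ℚ) p.b p.e p.f p.g (u / 2))
    (d3 := lprod denFR3 (p.a : ℚ) p.b p.e p.f p.g (u / 2))
    (tn := lprod tnFR (p.a : ℚ) p.b p.e p.f p.g (u / 2)) (td := lprod tdFR (p.a : ℚ) p.b p.e p.f p.g (u / 2))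
    (cnum := lprod cnumFR (p.a : ℚ) p.b p.e p.f p.g (u / 2)) (cnumS := lprod cnumSFR (p.a : ℚ) p.b p.e p.f p.g (u / 2))
    (cden := lprod cdenFR (p.a : ℚ) p.b p.e p.f p.g (u / 2)) (cdenS := lprod cdenSFR (p.a : ℚ) p.b p.e p.f p.g (u / 2))
    (x0 := xFRv (p.a : ℚ) p.b p.e p.f p.g) (x1 := xFRv (p.a : ℚ) p.b p.e p.f p.g)
    (by rw [denFR1_eval, numFR1_eval]; linear_combination r1)
    (by rw [denFR2_eval, numFR2_eval]; linear_combination r2)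
    (by rw [denFR3_eval, numFR3_eval]; linear_combination r3)
    (by rw [tdFR_eval, tnFR_eval]; linear_combination hS)
    (by rw [denFR1_eval]; intro h; exact hd1 (by linarith))
    (by rw [denFR2_eval]; exact mul_ne_zero (fun h => hd1 (by linarith)) (fun h => hd2 (by linarith)))
    (by rw [denFR3_eval]
        exact mul_ne_zero (mul_ne_zero (fun h => hd1 (by linarith)) (fun h => hd2 (by linarith))) (fun h => hd3 (by linarith)))
    (by rw [tdFR_eval]
        exact mul_ne_zero (mul_ne_zero (mul_ne_zero (mul_ne_zero (fun h => ht1 (by linarith)) (fun h => ht2 (by linarith)))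
          (fun h => ht3 (by linarith))) (fun h => ht4 (by linarith))) (fun h => ht5 (by linarith)))
    (by rw [cdenFR_eval]
        exact mul_ne_zero (mul_ne_zero (fun h => hd1 (by linarith)) (fun h => hd2 (by linarith))) (fun h => hd3 (by linarith)))
    (by rw [cdenSFR_eval]
        exact mul_ne_zero (mul_ne_zero (fun h => hd2 (by linarith)) (fun h => hd3 (by linarith))) (fun h => hd4 (by linarith)))
    (by rw [c0, c1, c2, c3]; linear_combination hc)
  rw [eG2, eG0, key, cnumSFR_eval, cnumFR_eval, cdenSFR_eval, cdenFR_eval]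
  unfold certFR
  push_cast
  ring

/-! ### Step (3): the DATA identity -/

/-- **Data identity** `Σ_k c^f_k(p)·vR(p+kδ_f) = S²G − G` (Lemma U over the exceptional set `SeR`). -/
theorem dataId_fR (h0 : p.Omega) (h1 : (p.addF 1).Omega) (h2 : (p.addF 2).Omega) (h3 : (p.addF 3).Omega) :
    PF.comb4 p.coefF ![p.vR, (p.addF 1).vR, (p.addF 2).vR, (p.addF 3).vR]
      = p.GfFR.shift.shift.add (p.GfFR.smul (-1)) := by
  have hp := h0.pos
  have hIcc : ∀ q : Pt, q.Omega → q.g = p.g → q.vR.poles ⊆ p.SeR := fun q hq hqg K hK => by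
    have := mem_Icc.1 (poles_vR_Icc hq hK); unfold SeR; rw [mem_Icc]; omega
  refine PF.eq_of_eval_eq_on _ _ p.SeR ?_ ?_ fun u hu => ?_
  · refine (PF.poles_comb4_subset _ _).trans (union_subset (union_subset ?_ ?_) (union_subset ?_ ?_)) <;>
      simp only [Matrix.cons_val_zero, Matrix.cons_val_one, Matrix.cons_val_two, Matrix.cons_val_three,
        Matrix.head_cons, Matrix.tail_cons]
    · exact hIcc p h0 rfl
    · exact hIcc _ h1 rfl
    · exact hIcc _ h2 rfl
    · exact hIcc _ h3 rfl
  · have hG : p.GfFR.poles ⊆ Icc 1 (5 * p.g) := fun K hK =>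
      mem_Icc.2 (mem_Icc_of_mem_e h0 (PF.poles_ofFrac _ _ _ hK))
    refine (PF.poles_shift2_sub_subset _).trans (union_subset ?_ (hG.trans fun K hK => ?_))
    · intro K hK
      obtain ⟨j, hj, rfl⟩ := mem_image.1 hK
      obtain ⟨i, hi, rfl⟩ := mem_image.1 hj
      have := mem_Icc.1 (hG hi); unfold SeR; rw [mem_Icc]; omega
    · have := mem_Icc.1 hK; unfold SeR; rw [mem_Icc]; omega
  · rw [PF.eval_comb4, PF.eval_shift2_sub, Fin.sum_univ_four]
    simp only [Matrix.cons_val_zero, Matrix.cons_val_one, Matrix.cons_val_two, Matrix.cons_val_three,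
      Matrix.head_cons, Matrix.tail_cons]
    exact funId_fR h0 h1 h2 h3 hu

/-! ### Step (4): legitimacy at the common node `M* = −a` -/

/-- At `u = −a` and `u = −a+1` the telescoped function has simple zeros and no pole: all four formal residues vanish. -/
theorem GfFR_altRes (h : p.Omega) :
    altRes0 (-p.a) p.GfFR = 0 ∧ altRes0 (-p.a + 1) p.GfFR = 0 ∧ altRes1 (-p.a) p.GfFR = 0 ∧
      altRes1 (-p.a + 1) p.GfFR = 0 := by
  obtain ⟨o1, o2, o3, o4, o5, o6, o7, o8, o9⟩ := h
  have hm : ∀ k ∈ p.AGe ∪ p.BG, twoRange p.AGe p.BG k = 1 ∨ twoRange p.AGe p.BG k = 2 := fun _ hk => twoRange_mem hk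
  have hnot : ∀ K : ℤ, K ≤ p.a → K ∉ p.AGe ∪ p.BG := fun K hK hmem => by
    rcases mem_union.1 hmem with h | h
    · obtain ⟨i, h1, h2, h3⟩ := mem_AGe.1 h; omega
    · obtain ⟨i, h1, h2, h3⟩ := mem_BG.1 h; omega
  have hdvd : ∀ K : ℤ, p.a - 1 ≤ K → K < p.g - p.b + p.a → lin K ∣ p.NGFR := fun K h1 h2 => by
    unfold NGFR; exact ((lin_dvd_block h1 h2).mul_right _).mul_left _
  unfold GfFR
  refine ⟨?_, ?_, ?_, ?_⟩
  · rw [altRes0_eq_eval]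
    refine mul_eq_zero_of_right _ (PF.eval_ofFrac_eq_zero_of_dvd _ _ _ hm (by rw [neg_neg]; exact hnot p.a le_rfl) ?_)
    rw [neg_neg]; exact hdvd p.a (by omega) (by omega)
  · rw [altRes0_eq_eval]
    refine mul_eq_zero_of_right _ ?_
    have e : -(-p.a + 1) = p.a - 1 := by ring
    exact PF.eval_ofFrac_eq_zero_of_dvd _ _ p.NGFR hm (M := -p.a + 1) (by rw [e]; exact hnot _ (by omega))
      (by rw [e]; exact hdvd _ (by omega) (by omega))
  · exact altRes1_ofFrac_eq_zero _ _ _ (by rw [neg_neg]; exact hnot p.a le_rfl)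
  · exact altRes1_ofFrac_eq_zero _ _ _ (by rw [show -(-p.a + 1) = p.a - 1 by ring]; exact hnot _ (by omega))

/-! ### Step (6): the second-tale recurrence of direction `f` -/

/-- **Direction `e`, second tale.** For `p, p+δ, p+2δ, p+3δ ∈ Ω` (`δ = δ_f`), the second-tale functionals at their own
nodes satisfy cert-2's telescoper (truncation `0`). -/
theorem recR_f (h0 : p.Omega) (h1 : (p.addF 1).Omega) (h2 : (p.addF 2).Omega) (h3 : (p.addF 3).Omega) :
    (p.coefF 0 * altE1 p.nodeR p.vR + p.coefF 1 * altE1 (p.addF 1).nodeR (p.addF 1).vR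
      + p.coefF 2 * altE1 (p.addF 2).nodeR (p.addF 2).vR + p.coefF 3 * altE1 (p.addF 3).nodeR (p.addF 3).vR = 0) ∧
    (p.coefF 0 * altE0 0 p.nodeR p.vR + p.coefF 1 * altE0 0 (p.addF 1).nodeR (p.addF 1).vR
      + p.coefF 2 * altE0 0 (p.addF 2).nodeR (p.addF 2).vR + p.coefF 3 * altE0 0 (p.addF 3).nodeR (p.addF 3).vR = 0) := by
  have hdata := dataId_fR h0 h1 h2 h3
  have hres := GfFR_altRes h0
  have m0 := altE_nodeR_neg_a h0 0
  have m1 := altE_nodeR_neg_a h1 0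
  have m2 := altE_nodeR_neg_a h2 0
  have m3 := altE_nodeR_neg_a h3 0
  simp only [addF_a] at m1 m2 m3
  have s1 := altE1_step2 (-p.a) p.coefF _ p.GfFR hdata
  have s0 := altE0_step2 0 (-p.a) p.coefF _ p.GfFR hdata (by rw [natDegree_GfFR h0])
  rw [Fin.sum_univ_four] at s1 s0
  simp only [Matrix.cons_val_zero, Matrix.cons_val_one, Matrix.cons_val_two, Matrix.cons_val_three,
    Matrix.head_cons, Matrix.tail_cons] at s1 s0
  rw [hres.2.2.1, hres.2.2.2] at s1
  rw [hres.1, hres.2.1] at s0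
  rw [m0.2, m1.2, m2.2, m3.2, m0.1, m1.1, m2.1, m3.1]
  constructor
  · linarith
  · linarith

end Pt

end Summit.KontsevichZagierPeriods.Zeta5Search.TwoTaleOmega

end
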